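import Summits.RiemannHypothesis.RiemannHypothesis.Theorems.PfPersistenceCoupledPresentation
import HarnessLib

/-!
# PF persistence — the coupled presentation ALONG ANCHOR MAPS: offset vectors (A158 (A2)), mixed truncations
# (A159 (A2)), log-prime steps — one typing, same proofs (pub-rhpf barrier-typer gen 8; deprecate-and-add)

**HONEST FRAMING. Long-odds MECHANISM SEARCH; no RH claims.** RH-free bookkeeping about the SHAPE of criteria
(labels PROVED / TYPED as in `PfPersistenceAdmissibleClass.lean`). CONTEXT: `PfPersistenceCoupledPresentation`
(951862827d34) typed clause (1′) `IsCoupledOpen k h hh` for readers whose `k` anchors are the arithmetic progression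
`win, win + h, …, win + (k−1)h` at ONE truncation `N(win)`; RULING A158 (A2) scoped the one-theorem W1 cite
(`not_separates_coupledClassOn_below`) to exactly those readers and asked for the OFFSET-VECTOR addendum
(`CoupledReaderOff (off : Fin k → ℝ)`, `tupleAtOff`, W1 below `A + sup off`) before Δq_M ladders / log-prime steps /
mixed-offset readers may cite one theorem; RULING A159 (A2) asked the same for CROSS-`N` readers. This file does both
at once by presenting a joint reader ALONG ANCHOR MAPS `τ : Fin k → Window → Window` (at anchor `win` the reader sees
the blocks at `τ 0 win, …, τ (k−1) win`):
§1 defs `CoupledReaderAlong τ`, `tupleAlong`, `coupledClassAlong(On)`, `IsCoupledOpenAlong τ S`; the single-stride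
presentation of record is the instance `τ = strideMaps k h hh` (`isCoupledOpen_iff_along`, definitional).
§2 clause (3) is AUTOMATIC along INJECTIVE anchor maps (`IsCoupledOpenAlong.stableAlong` / `.dialStable`: patch `ζ`
at one window — injectivity makes at most `k` anchors read it, a finite intersection of open conditions); schema
`InG1along τ := IsCoupledOpenAlong τ ∧ NonlocalAtEveryHeight ∧ DialStable`, certificate `inG1along_of`;
`InG1coupled k h hh ⇒ InG1along (strideMaps k h hh)`; window-wise open ⇒ coupled-open along any maps with an identity
coordinate.
§3 W1 ON BOUNDED ANCHOR SETS along HEIGHT-BOUNDED maps (`(τ j win).a ≤ win.a + B`): anchors below `A` ⇒ decided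
below `A + B` ⇒ separates nothing on any `D ⊇ arithDialSpace` (`not_separates_coupledClassAlongOn_below`).
§4 the instances of record: OFFSET VECTORS `offsetMaps off hoff` (anchors `win + off j`, same `N`; the A158 (A2)
names `CoupledReaderOff` / `tupleAtOff` / `coupledClassOff(On)` are these, W1 below `A + B` for any bound `off ≤ B`,
e.g. `B = sup off`), MIXED-`N` OFFSETS `offsetMapsN off hoff dN` (anchors `(a + off j, N + dN j)`, A159 (A2)), and the
stride maps (W1 below `A + k·h`, recovering 951862827d34 §4). All three are injective and height-bounded, so every
Δq_M ladder over distinct primes (offsets `log q_M`-type constants), every log-prime-step reader, every mixed-`N`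
pair reader AS RUN on a bounded atlas is 'closed-global above A + B' by ONE theorem, and its `∀ anchors` version has
the `InG1along` certificate schema with clause (3) free.
NOT SAID: the ALL-PAIRS `transportTwin` (94721571e2b4) reads unboundedly many windows per anchor and is NOT a reader
along finitely many anchor maps (its words stand); no strength word for any member (E1 words attach only where a
theorem gives them, A158 (A3)); no `ζ` sentence; W2 untouched.
-/

set_option linter.dupNamespace false  -- the mandated namespace repeats `RiemannHypothesis`

noncomputable section

open Real Set Matrix Filter Topology
open Literature.NumberTheory.LFunctions
open Summit.RiemannHypothesis.RiemannHypothesis.Theorems.SpectralTraceWindowStep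

namespace Summit.RiemannHypothesis.RiemannHypothesis.Theorems.PfPersistence

/-! ## §1 Joint readers along anchor maps -/

/-- a `k`-WINDOW JOINT READER ALONG ANCHOR MAPS `τ`: at each anchor `win`, a set of `k`-tuples of blocks, the `j`-th
block living at the window `τ j win` (its own truncation). [folklore] -/
abbrev CoupledReaderAlong {k : ℕ} (τ : Fin k → Window → Window) : Type :=
  (win : Window) → Set ((j : Fin k) → Matrix (Fin ((τ j win).N + 1)) (Fin ((τ j win).N + 1)) ℝ)

/-- the TUPLE of blocks of `d` seen from the anchor `win` along `τ`. [folklore] -/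
def tupleAlong {k : ℕ} (τ : Fin k → Window → Window) (d : Datum) (win : Window) :
    (j : Fin k) → Matrix (Fin ((τ j win).N + 1)) (Fin ((τ j win).N + 1)) ℝ :=
  fun j => d (τ j win)

/-- the COUPLED CLASS of a joint reader along `τ` (verdict imposed at EVERY anchor). [folklore] -/
def coupledClassAlong {k : ℕ} (τ : Fin k → Window → Window) (P : CoupledReaderAlong τ) : Set Datum :=
  {d | ∀ win, tupleAlong τ d win ∈ P win}

/-- the coupled class along `τ` with anchors restricted to `T` (served grids, bounded atlases). [folklore] -/
def coupledClassAlongOn (T : Set Window) {k : ℕ} (τ : Fin k → Window → Window) (P : CoupledReaderAlong τ) :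
    Set Datum :=
  {d | ∀ win ∈ T, tupleAlong τ d win ∈ P win}

/-- **TYPED — clause (1′) ALONG ANCHOR MAPS:** `S` is the coupled class of a joint reader along `τ` with OPEN verdict
sets. [folklore] -/
def IsCoupledOpenAlong {k : ℕ} (τ : Fin k → Window → Window) (S : Set Datum) : Prop :=
  ∃ P : CoupledReaderAlong τ, (∀ win, IsOpen (P win)) ∧ S = coupledClassAlong τ P

/-- PROVED: the top-free class is contained in every restricted one. [folklore] -/
theorem coupledClassAlong_subset_on (T : Set Window) {k : ℕ} (τ : Fin k → Window → Window)
    (P : CoupledReaderAlong τ) : coupledClassAlong τ P ⊆ coupledClassAlongOn T τ P :=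
  fun _ hd win _ => hd win

/-- the SINGLE-STRIDE look-ahead maps `j ↦ (win ↦ win + j·h)` — the presentation of 951862827d34. [folklore] -/
def strideMaps (k : ℕ) (h : ℝ) (hh : 0 ≤ h) : Fin k → Window → Window := fun j win => win.lookAhead h hh j

/-- PROVED (definitional): the single-stride coupled class is the class along the stride maps. [folklore] -/
theorem coupledClass_eq_along (k : ℕ) (h : ℝ) (hh : 0 ≤ h) (P : CoupledReader k h hh) :
    coupledClass k h hh P = coupledClassAlong (strideMaps k h hh) P := rfl

/-- PROVED (definitional): likewise with restricted anchors. [folklore] -/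
theorem coupledClassOn_eq_along (T : Set Window) (k : ℕ) (h : ℝ) (hh : 0 ≤ h) (P : CoupledReader k h hh) :
    coupledClassOn T k h hh P = coupledClassAlongOn T (strideMaps k h hh) P := rfl

/-- **PROVED — the stratum of record is the instance `τ = strideMaps k h hh`** of the anchor-map presentation. [folklore] -/
theorem isCoupledOpen_iff_along {k : ℕ} {h : ℝ} {hh : 0 ≤ h} {S : Set Datum} :
    IsCoupledOpen k h hh S ↔ IsCoupledOpenAlong (strideMaps k h hh) S :=
  Iff.rfl

/-! ## §2 Clause (3) is automatic along injective anchor maps; the certificate schema -/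

/-- **PROVED — a class COUPLED-OPEN ALONG INJECTIVE anchor maps and `∋ ζ` is STABLE ALONG every window-wise
convergent dial:** patch `ζ` at `win`; by injectivity at most one anchor per coordinate `j` reads `win`, so
membership of the patched datum is a finite intersection of open conditions at `ζ win`. [folklore] -/
theorem IsCoupledOpenAlong.stableAlong {k : ℕ} {τ : Fin k → Window → Window} {S : Set Datum}
    (hS : IsCoupledOpenAlong τ S) (hinj : ∀ j, Function.Injective (τ j)) (hζ : zetaDatum ∈ S) {ι : Type*}
    {l : Filter ι} {c : ι → Datum} (hc : ∀ win, Tendsto (fun i => c i win) l (𝓝 (zetaDatum win))) :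
    StableAlong S l c := by
  classical
  obtain ⟨P, hP, rfl⟩ := hS
  intro win
  have hφ : ∀ w : Window, Continuous fun M : Matrix (Fin (win.N + 1)) (Fin (win.N + 1)) ℝ =>
      tupleAlong τ (Function.update zetaDatum win M) w := fun w =>
    continuous_pi fun j => (continuous_apply (τ j w)).comp (continuous_const.update win continuous_id)
  -- the only anchors whose tuple contains `win`: for each `j`, the unique preimage of `win` under `τ j` (if any)
  let anchor : Fin k → Window := fun j => if hj : ∃ w, τ j w = win then hj.choose else win
  have hanch : ∀ (w : Window) (j : Fin k), τ j w = win → w = anchor j := by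
    intro w j e
    have hj : ∃ w, τ j w = win := ⟨w, e⟩
    have h1 : anchor j = hj.choose := dif_pos hj
    rw [h1]
    exact hinj j (e.trans hj.choose_spec.symm)
  have hV : IsOpen (⋂ j : Fin k,
      (fun M => tupleAlong τ (Function.update zetaDatum win M) (anchor j)) ⁻¹' P (anchor j)) :=
    isOpen_iInter_of_finite fun j => (hP _).preimage (hφ _)
  have hζV : zetaDatum win ∈ ⋂ j : Fin k,
      (fun M => tupleAlong τ (Function.update zetaDatum win M) (anchor j)) ⁻¹' P (anchor j) := by
    simp only [mem_iInter, mem_preimage, Function.update_eq_self]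
    exact fun j => hζ (anchor j)
  refine ((hc win).eventually_mem (hV.mem_nhds hζV)).mono fun i hi => ?_
  refine ⟨Function.update zetaDatum win (c i win), fun w => ?_, by simp⟩
  by_cases hw : ∃ j : Fin k, τ j w = win
  · obtain ⟨j, hj⟩ := hw
    have hw' := hanch w j hj
    subst hw'
    simp only [mem_iInter, mem_preimage] at hi
    exact hi j
  · have : tupleAlong τ (Function.update zetaDatum win (c i win)) w = tupleAlong τ zetaDatum w :=
      funext fun j => Function.update_of_ne (fun e => hw ⟨j, e⟩) _ _
    rw [this]
    exact hζ w

/-- **PROVED — clause (3) is discharged along injective anchor maps** (as along strides). [folklore] -/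
theorem IsCoupledOpenAlong.dialStable {k : ℕ} {τ : Fin k → Window → Window} {S : Set Datum}
    (hS : IsCoupledOpenAlong τ S) (hinj : ∀ j, Function.Injective (τ j)) : DialStable S := fun hζ =>
  ⟨fun p _ => hS.stableAlong hinj hζ fun win => (tendsto_pDial p win).mono_left nhdsWithin_le_nhds,
    hS.stableAlong hinj hζ fun win => (tendsto_shiftDial win).mono_left nhdsWithin_le_nhds⟩

/-- **TYPED — `G1-along(τ)`:** coupled-open along `τ` ∧ non-local at every height ∧ dial-stable. [folklore] -/
def InG1along {k : ℕ} (τ : Fin k → Window → Window) (S : Set Datum) : Prop :=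
  IsCoupledOpenAlong τ S ∧ NonlocalAtEveryHeight S ∧ DialStable S

/-- PROVED — the MEMBERSHIP CERTIFICATE schema along injective maps: open verdict sets + height exits. [folklore] -/
theorem inG1along_of {k : ℕ} {τ : Fin k → Window → Window} {S : Set Datum} (hS : IsCoupledOpenAlong τ S)
    (hinj : ∀ j, Function.Injective (τ j)) (hnl : NonlocalAtEveryHeight S) : InG1along τ S :=
  ⟨hS, hnl, hS.dialStable hinj⟩

/-- PROVED: `G1-coupled(k, h) ⇒ G1-along(strideMaps k h hh)` (the record stratum is an instance). [folklore] -/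
theorem InG1coupled.inG1along {k : ℕ} {h : ℝ} {hh : 0 ≤ h} {S : Set Datum} (hG : InG1coupled k h hh S) :
    InG1along (strideMaps k h hh) S :=
  ⟨isCoupledOpen_iff_along.1 hG.1, hG.2.1, hG.2.2⟩

/-- PROVED — W1 does not apply to a `G1-along` member (clause (2)). [folklore] -/
theorem InG1along.not_finitelyDetermined {k : ℕ} {τ : Fin k → Window → Window} {S : Set Datum}
    (hG : InG1along τ S) : ¬ FinitelyDetermined S :=
  hG.2.1.not_finitelyDetermined

/-- **PROVED — every WINDOW-WISE OPEN set is coupled-open along any anchor maps with an IDENTITY coordinate**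
(`τ j₀ = id`: the reader tests its own anchor and ignores the other coordinates). [folklore] -/
theorem IsWindowwiseOpen.isCoupledOpenAlong {S : Set Datum} (hS : IsWindowwiseOpen S) {k : ℕ}
    (τ : Fin k → Window → Window) (j₀ : Fin k) (hj₀ : ∀ win, τ j₀ win = win) : IsCoupledOpenAlong τ S := by
  obtain ⟨U, hU, rfl⟩ := hS
  refine ⟨fun win => {m | ∀ j : Fin k, m j ∈ U (τ j win)}, fun win => ?_, ?_⟩
  · dsimp only
    rw [Set.setOf_forall]
    exact isOpen_iInter_of_finite fun j => (hU _).preimage (continuous_apply j)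
  · ext d
    simp only [coupledClassAlong, tupleAlong, mem_setOf_eq]
    refine ⟨fun hd win j => hd _, fun hd win => ?_⟩
    have := hd win j₀
    rw [hj₀ win] at this
    exact this

/-! ## §3 W1 on bounded anchor sets along height-bounded maps — one theorem -/

/-- PROVED: along maps of height excess `≤ B`, a class anchored below `A` is DECIDED below `A + B`. [folklore] -/
theorem determinedOn_coupledClassAlongOn_below {A B : ℝ} {T : Set Window} (hT : T ⊆ below A) {k : ℕ}
    {τ : Fin k → Window → Window} (hB : ∀ j win, (τ j win).a ≤ win.a + B) (P : CoupledReaderAlong τ) :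
    DeterminedOn (coupledClassAlongOn T τ P) (below (A + B)) := by
  intro d d' hdd'
  simp only [coupledClassAlongOn, mem_setOf_eq]
  refine forall₂_congr fun win hwin => ?_
  have : tupleAlong τ d win = tupleAlong τ d' win := funext fun j => hdd' _ (by
    show (τ j win).a ≤ A + B
    have ha : win.a ≤ A := hT hwin
    linarith [hB j win])
  rw [this]

/-- **PROVED — W1 for EVERY joint reader along HEIGHT-BOUNDED anchor maps on a BOUNDED anchor set** (every
`D ⊇ arithDialSpace`): anchors below `A`, height excess `≤ B` ⇒ no separation of `ζ` from the negatives (a heavy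
prime dial above `A + B` is a member, `≠ ζ`, negative). Served / finite anchor sets are DATA. [folklore] -/
theorem not_separates_coupledClassAlongOn_below {D : Set Datum} (hD : arithDialSpace ⊆ D) {A B : ℝ}
    {T : Set Window} (hT : T ⊆ below A) {k : ℕ} {τ : Fin k → Window → Window}
    (hB : ∀ j win, (τ j win).a ≤ win.a + B) (P : CoupledReaderAlong τ) :
    ¬ Separates (coupledClassAlongOn T τ P) D zetaDatum :=
  not_separates_of_determinedOn_below_arith hD (determinedOn_coupledClassAlongOn_below hT hB P)

/-! ## §4 The instances of record: offset vectors (A158 (A2)), mixed truncations (A159 (A2)), strides -/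

/-- OFFSET-VECTOR anchor maps: the `j`-th block lives at `win + off j` (same truncation). [folklore] -/
def offsetMaps {k : ℕ} (off : Fin k → ℝ) (hoff : ∀ j, 0 ≤ off j) : Fin k → Window → Window :=
  fun j win => win.stepUp (off j) (hoff j)

/-- MIXED-TRUNCATION offset maps: the `j`-th block lives at `(a + off j, N + dN j)`. [folklore] -/
def offsetMapsN {k : ℕ} (off : Fin k → ℝ) (hoff : ∀ j, 0 ≤ off j) (dN : Fin k → ℕ) : Fin k → Window → Window :=
  fun j win => ⟨win.a + off j, win.N + dN j, add_pos_of_pos_of_nonneg win.ha (hoff j)⟩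

/-- the A158 (A2) name: an OFFSET-VECTOR joint reader (`k` blocks at `win + off j`, same `N`). [folklore] -/
abbrev CoupledReaderOff {k : ℕ} (off : Fin k → ℝ) (hoff : ∀ j, 0 ≤ off j) : Type :=
  CoupledReaderAlong (offsetMaps off hoff)

/-- the A158 (A2) name: the tuple of blocks at the offset windows. [folklore] -/
abbrev tupleAtOff {k : ℕ} (off : Fin k → ℝ) (hoff : ∀ j, 0 ≤ off j) (d : Datum) (win : Window) :
    (j : Fin k) → Matrix (Fin ((offsetMaps off hoff j win).N + 1)) (Fin ((offsetMaps off hoff j win).N + 1)) ℝ :=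
  tupleAlong (offsetMaps off hoff) d win

/-- the A158 (A2) name: the offset-vector coupled class (every anchor). [folklore] -/
abbrev coupledClassOff {k : ℕ} (off : Fin k → ℝ) (hoff : ∀ j, 0 ≤ off j) (P : CoupledReaderOff off hoff) :
    Set Datum :=
  coupledClassAlong (offsetMaps off hoff) P

/-- the A158 (A2) name: the offset-vector coupled class on an anchor set `T`. [folklore] -/
abbrev coupledClassOffOn (T : Set Window) {k : ℕ} (off : Fin k → ℝ) (hoff : ∀ j, 0 ≤ off j)
    (P : CoupledReaderOff off hoff) : Set Datum :=
  coupledClassAlongOn T (offsetMaps off hoff) P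

/-- PROVED: offset maps are injective (subtract the offset). [folklore] -/
theorem offsetMaps_injective {k : ℕ} (off : Fin k → ℝ) (hoff : ∀ j, 0 ≤ off j) (j : Fin k) :
    Function.Injective (offsetMaps off hoff j) := by
  rintro ⟨a, N, ha⟩ ⟨a', N', ha'⟩ e
  have h1 := congrArg Window.a e
  have h2 := congrArg Window.N e
  simp only [offsetMaps, Window.stepUp] at h1 h2
  have : a = a' := by linarith
  subst this; subst h2; rfl

/-- PROVED: offset maps have height excess `≤ B` for any bound `off ≤ B` (e.g. `B = sup_j off j`). [folklore] -/
theorem offsetMaps_height {k : ℕ} (off : Fin k → ℝ) (hoff : ∀ j, 0 ≤ off j) {B : ℝ} (hB : ∀ j, off j ≤ B)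
    (j : Fin k) (win : Window) : (offsetMaps off hoff j win).a ≤ win.a + B := by
  show win.a + off j ≤ win.a + B
  linarith [hB j]

/-- PROVED: mixed-truncation offset maps are injective. [folklore] -/
theorem offsetMapsN_injective {k : ℕ} (off : Fin k → ℝ) (hoff : ∀ j, 0 ≤ off j) (dN : Fin k → ℕ) (j : Fin k) :
    Function.Injective (offsetMapsN off hoff dN j) := by
  rintro ⟨a, N, ha⟩ ⟨a', N', ha'⟩ e
  have h1 := congrArg Window.a e
  have h2 := congrArg Window.N e
  simp only [offsetMapsN] at h1 h2
  have : a = a' := by linarith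
  subst this
  have : N = N' := by omega
  subst this; rfl

/-- PROVED: mixed-truncation offset maps have height excess `≤ B` for any bound `off ≤ B`. [folklore] -/
theorem offsetMapsN_height {k : ℕ} (off : Fin k → ℝ) (hoff : ∀ j, 0 ≤ off j) (dN : Fin k → ℕ) {B : ℝ}
    (hB : ∀ j, off j ≤ B) (j : Fin k) (win : Window) : (offsetMapsN off hoff dN j win).a ≤ win.a + B := by
  show win.a + off j ≤ win.a + B
  linarith [hB j]

/-- PROVED: stride maps are injective. [folklore] -/
theorem strideMaps_injective (k : ℕ) (h : ℝ) (hh : 0 ≤ h) (j : Fin k) :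
    Function.Injective (strideMaps k h hh j) := by
  rintro ⟨a, N, ha⟩ ⟨a', N', ha'⟩ e
  have h1 := congrArg Window.a e
  have h2 := congrArg Window.N e
  simp only [strideMaps, Window.lookAhead, Window.stepUp] at h1 h2
  have : a = a' := by linarith
  subst this; subst h2; rfl

/-- PROVED: stride maps have height excess `≤ k·h`. [folklore] -/
theorem strideMaps_height (k : ℕ) (h : ℝ) (hh : 0 ≤ h) (j : Fin k) (win : Window) :
    (strideMaps k h hh j win).a ≤ win.a + k * h := by
  show win.a + (j : ℕ) * h ≤ win.a + k * h
  have hj : ((j : ℕ) : ℝ) ≤ k := by exact_mod_cast j.is_lt.le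
  nlinarith

/-- **PROVED — W1 FOR OFFSET-VECTOR READERS ON BOUNDED ANCHOR SETS (A158 (A2) as asked):** anchors below `A`,
offsets `≤ B` ⇒ no separation on any `D ⊇ arithDialSpace` (decided below `A + B`). Covers Δq_M ladders over
distinct primes, log-prime-step readers, any fixed finite offset pattern at one truncation. [folklore] -/
theorem not_separates_coupledClassOffOn_below {D : Set Datum} (hD : arithDialSpace ⊆ D) {A B : ℝ}
    {T : Set Window} (hT : T ⊆ below A) {k : ℕ} (off : Fin k → ℝ) (hoff : ∀ j, 0 ≤ off j)
    (hB : ∀ j, off j ≤ B) (P : CoupledReaderOff off hoff) :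
    ¬ Separates (coupledClassOffOn T off hoff P) D zetaDatum :=
  not_separates_coupledClassAlongOn_below hD hT (offsetMaps_height off hoff hB) P

/-- **PROVED — W1 FOR MIXED-TRUNCATION OFFSET READERS ON BOUNDED ANCHOR SETS (A159 (A2) as asked).** [folklore] -/
theorem not_separates_coupledClassAlongOn_offsetMapsN_below {D : Set Datum} (hD : arithDialSpace ⊆ D) {A B : ℝ}
    {T : Set Window} (hT : T ⊆ below A) {k : ℕ} (off : Fin k → ℝ) (hoff : ∀ j, 0 ≤ off j) (dN : Fin k → ℕ)
    (hB : ∀ j, off j ≤ B) (P : CoupledReaderAlong (offsetMapsN off hoff dN)) :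
    ¬ Separates (coupledClassAlongOn T (offsetMapsN off hoff dN) P) D zetaDatum :=
  not_separates_coupledClassAlongOn_below hD hT (offsetMapsN_height off hoff dN hB) P

/-- PROVED (consistency): the single-stride W1 theorem of 951862827d34 §4 is the stride-map instance. [folklore] -/
example {D : Set Datum} (hD : arithDialSpace ⊆ D) {A : ℝ} {T : Set Window} (hT : T ⊆ below A) (k : ℕ) (h : ℝ)
    (hh : 0 ≤ h) (P : CoupledReader k h hh) : ¬ Separates (coupledClassOn T k h hh P) D zetaDatum := by
  rw [coupledClassOn_eq_along]
  exact not_separates_coupledClassAlongOn_below hD hT (strideMaps_height k h hh) P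

/-- **PROVED — THE CERTIFICATE SCHEMA for offset-vector readers:** open verdict sets + height exits ⇒
`G1-along(offsetMaps off)` with clause (3) free (offset maps are injective). [folklore] -/
theorem inG1along_offsetMaps_of {k : ℕ} {off : Fin k → ℝ} {hoff : ∀ j, 0 ≤ off j} {S : Set Datum}
    (hS : IsCoupledOpenAlong (offsetMaps off hoff) S) (hnl : NonlocalAtEveryHeight S) :
    InG1along (offsetMaps off hoff) S :=
  inG1along_of hS (offsetMaps_injective off hoff) hnl

/-- PROVED — likewise for mixed-truncation offset readers. [folklore] -/
theorem inG1along_offsetMapsN_of {k : ℕ} {off : Fin k → ℝ} {hoff : ∀ j, 0 ≤ off j} {dN : Fin k → ℕ}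
    {S : Set Datum} (hS : IsCoupledOpenAlong (offsetMapsN off hoff dN) S) (hnl : NonlocalAtEveryHeight S) :
    InG1along (offsetMapsN off hoff dN) S :=
  inG1along_of hS (offsetMapsN_injective off hoff dN) hnl

end Summit.RiemannHypothesis.RiemannHypothesis.Theorems.PfPersistence

end
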